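import Summits.HodgeConjecture.HodgeConjecture.Theorems.F0P6aSerreTensorFibreMarkedAtSiegelPoint   -- ★ p850866 (LA4-p03 (g3)) DEAL #42 §1 `exists_markedSerreTensorFibre` (brings ★ σ1-UNPACK p850665, ★ (D), ★ E6 sockets, ★ pin, ★ p850517)
import Literature.AlgebraicGeometry.ShimuraVarieties.UnitaryCurveAuxiliaryTorusLegLift                 -- ★ p850805 (LA5-p02 (g4)) DEAL #41 `exists_isLambdaOfAt_symplecticLift_torusLeg`
import Literature.AlgebraicGeometry.AbelianSchemes.SerreTwistPolarization                             -- ★ `IsExactTwistPol`, `isExactTwistPol_iff` ((t3) of the exact twist)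
import Literature.AlgebraicGeometry.Motives.GaloisThickening                                           -- ★ `thickeningLift`, `thickeningLift_left_comp_fst∕snd` (the sheet point `ℓ_e z₀`)
import Literature.AlgebraicGeometry.ShimuraVarieties.UnitaryShimuraCurveRecordMorphisms               -- ★ `RecordSystemGS.HeckeTranslateDefinedOver` (the letter՚s (U7ₛ) binder)
import Literature.NumberTheory.NumberFields.IdealClassCoprimeRepresentative                           -- ★ `pointwise_smul_ne_bot` (`n ≠ 0` from rows (a)(c))
import HarnessLib

/-!
# ORGAN (B1) «FIBRE LIFT AT THE SPECIAL SHEET POINTS OF THE TWISTED TUPLE» — PAID (★ twin of the socket of LA7-p01 (g4)՚s LEG-E(γ′) frame)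

Cell `hodgecm-mathlib` (D-0151), FLOOR 0, P6 «MOD programme», crux hLiu418 (stmt-HodgeConjecture-24832, `--supports`, count-neutral), line «L4», (S8) sheet-line
closer `Lines/F0_P6a_StubESHEET.lean`, road (γ′) «Serre tensor over `X`, classified».  LA7-p01 (g4)՚s HOME frame `OrganSHEETGlobalPay.frame.v1` (sha16 709ce1f8)
proves `organSHEETGlobal_of_organs : OrganB1 → OrganB2 → OrganB3 → OrganSHEETGlobalCore`; its §2a socket `def OrganB1 : Prop` (DEAL #41, LA4-plan (g2)
2026-09-02 09:09:56Z (5); LA4-p05 (g5) 09:50:52Z holder query; LA5-p02 (g4) «mine» 09:52Z) is PAID HERE: **`organB1_holds`** has, as its statement, the BODY OF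
`OrganB1` VERBATIM (frame :527–:569).  Every constant of that body has the same fully-qualified name in the `Lines/` originals and in the ★ re-homed twins
(namespaces kept, LEAD «M-72»), so once the «K3» shims serve the twins the frame closes its socket by `theorem organB1 : OrganB1 := organB1_holds` (one line);
before «K3» no single file can import both the `Lines` (D) layer and ★ σ1-UNPACK («already contains»), which is why the payer is a ★ twin over ★ imports only.

ED. 2 (LA5-p02 (g5), tactic hygiene, statement byte-identical): the four `obtain ⟨…⟩ := <application>` steps are now `have h := <application>` followed by
`obtain ⟨…⟩ := h` — `rcases` on a NON-variable term first generalises it over the goal, and on these goals that costs ≈ 95 000 heartbeats per call (measured with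
`#count_heartbeats`: 4 × ≈ 95k of the ≈ 395k total), whereas on a hypothesis it costs 2–6k; the declaration now runs in ≈ 30 000 heartbeats and the
`set_option maxHeartbeats 800000 in` is gone (default budget).

THE MATHEMATICS ([Shimura1998] §18.6 Thm. 18.6 and its proof: `A ⊗ 𝔞⁻¹ = ℂ^g ∕ 𝔞⁻¹Λ` with its level structure moved by the idèle `z`, `[z] = 𝔞⁻¹`; [Lan2013PELCompactifications]
§1.3.6 Lemma 1.3.6.5: the symplectic lift at a geometric point; [Milne2005ShimuraVarieties] Thm. 6.11, (63); [MumfordFogartyKirwan1994] Ch. 6 §2 Def. 6.3: the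
polarisation witness at a geometric point).  At the sheet point `x := ℓ_{eE}(z₀)` of `X = (M_{Kc}) ⊗_F Fᵢ` (★ `thickeningLift`; a `τE`-complex point of `X` since `eE = τE`
on elements) DEAL #42 §1 ★ `exists_markedSerreTensorFibre` gives σ1՚s marked fibre `(m, Θ, Λ)` of `P_x` at the moved representative `r′ = (q a)⁻¹ b a` (`Λ` read through
`rep⁻¹ = k·r′⁻¹`, `k ∈ K_δ(N)`) and the marking `m_B` of `(P ⊗ 𝔞⁻¹)_x` by `[J, r′·ũ_V(1,t)]` reading the cover `ψ_P` as `id`; the rows of the twist needed at `x` —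
(t3) = `IsExactTwistPol` (★ `isExactTwistPol_iff`) and (surj) (★ `serreCover_rows_of_presentation`) — are global; the torus idèle `t ∈ T(𝔸_f)` carries its multiplier
`q` (`t t̄ = q ⊗ 1`, the defining witness of ★ `torusFinAdelic`); ★ p850805 `exists_isLambdaOfAt_symplecticLift_torusLeg` then yields an ample witness `Θ₂` of `λ_B` at
`x` with `IsLambdaOfAt` and a symplectic lift `Λ₂` of `η_B(x)` of type `δ` (read through `(r′ũ)⁻¹` by `m_B`) — a fortiori the socket՚s `∃ Θ, IsLambdaOfAt ∧ Nonempty (SymplecticLift …)`.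

* **`organB1_holds`** — the body of `OrganB1` VERBATIM, proved.
THEOREMS ONLY (no definition, no instance, no named fact, no `sorry`); default heartbeats except the statement՚s elaboration budget (as the frame).  HONEST LABEL:
HC_CM is proved only modulo the 7 printed citations (2 remaining named inputs hLiu418 = stmt-HodgeConjecture-24832, h413 = stmt-HodgeConjecture-24833) until rung 0
closes; this file is count-neutral.

## References
* [Shimura1998] G. Shimura, *Abelian Varieties with Complex Multiplication and Modular Functions* (1998), §18.6 Thm. 18.6 pp. 124–125, proof pp. 127–129.
* [Lan2013PELCompactifications] K.-W. Lan, *Arithmetic compactifications of PEL-type Shimura varieties* (2013), §1.3.6 Lemma 1.3.6.5 (p. 81), Lemma 1.3.6.6 and Cor. 1.3.6.7 (pp. 81–82).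
* [Milne2005ShimuraVarieties] J. S. Milne, *Introduction to Shimura varieties* (2005), §6 Thm. 6.11 pp. 74–75, §12 (63) p. 116.
* [MumfordFogartyKirwan1994] D. Mumford, J. Fogarty, F. Kirwan, *Geometric Invariant Theory* (3rd ed. 1994), Ch. 6 §2 Definition 6.3 (p. 120).
-/

set_option autoImplicit false

noncomputable section

namespace Summit.HodgeConjecture.HodgeConjecture.Theorems.F0P6aOrganB1FibreLift

set_option linter.dupNamespace false  -- `Summit.HodgeConjecture.HodgeConjecture.…` BY DESIGN (D-0017)

open CategoryTheory CategoryTheory.Limits NumberField IsDedekindDomain MulAction AlgebraicGeometry Topology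
open scoped Matrix Polynomial Pointwise nonZeroDivisors MonObj
open Literature.NumberTheory.GaloisRepresentations
open Literature.NumberTheory.Automorphic Literature.NumberTheory.Automorphic.UnitaryGroup
open Literature.AlgebraicGeometry.ShimuraVarieties Literature.AlgebraicGeometry.ShimuraVarieties.UnitaryCanonicalModel
open Literature.NumberTheory.Automorphic.Liu2021.AppendixC
open Literature.AlgebraicGeometry.Motives (AlgPoints ComplexPoints SchemeOver thickeningLift specOver CartierDivisor CMType)
open Literature.AlgebraicGeometry.Motives.AbelianVariety (bcSpec)
open Literature.AlgebraicGeometry.AbelianSchemes (PolarizedAbelianSchemeWithLevel AbelianSchemeOver)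
open Literature.AlgebraicGeometry.ModuliOfAbelianVarieties
open Summit.HodgeConjecture.HodgeConjecture.Cruxes.HLiu418.F0P6aPELWitnessE
open Summit.HodgeConjecture.HodgeConjecture.Cruxes.HLiu418.F0P6aStubE6 (RingActionReading)
open Summit.HodgeConjecture.HodgeConjecture.Cruxes.HLiu418.F0P6aChartFramePin (IsChartOfFrame)
open Literature.AlgebraicGeometry.ShimuraVarieties.UnitaryCanonicalModel.Aux (ratBasis torusFinAdelic reflexField numberField_reflexField)
open Literature.AlgebraicGeometry.ShimuraVarieties.UnitaryCurve Literature.AlgebraicGeometry.ShimuraVarieties.UnitaryCurve.AuxV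
open Literature.NumberTheory.ComplexMultiplication (reflexNormFiniteIdele)
open Literature.NumberTheory.ComplexMultiplication.CMTypeOps (flip bar)
open Summit.HodgeConjecture.HodgeConjecture.Theorems.F0P6aSerreTensorFibreMarkedAtSiegelPoint (exists_markedSerreTensorFibre)

/-- **ORGAN (B1) PAID — `organB1_holds : <body of OrganB1>`** (LA7-p01 (g4) frame v1 §2a VERBATIM): in the letter՚s chart context, for ideal data `(𝔞, n)` with rows
(c)(a)(b) and a torus idèle `t` with `[t] = 𝔞⁻¹`, `t ≡ 1 mod N`, for every Serre presentation `(E′, Pm, Qm)` of `𝔞⁻¹` with scalar `n`, every unit-normalised dual pair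
`Db` of `P.A ⊗ 𝔞⁻¹`, every polarisation `λ_B` EXACT for the cover and every level structure `η_B` transported along the cover, and every special point
`z₀ = (S.pts Kc)⁻¹[ι₁w, aKc]`: a `λ_B`-witness `Θ` at the sheet point `ℓ_{eE}(z₀)` with a SYMPLECTIC LIFT of `η_B` of type `δ` — by DEAL #42 §1 ★ p850866 at
`x := ℓ_{eE}(z₀)` and DEAL #41 ★ p850805 at the torus leg `r′·ũ_V(1,t)` ((t3) = `IsExactTwistPol`, (surj) from the presentation, `q` from `t ∈ T(𝔸_f)`).
[cite: Shimura1998, §18.6 Thm. 18.6 pp. 124–125 and proof pp. 127–129] [cite: Lan2013PELCompactifications, §1.3.6 Lemma 1.3.6.5 (p. 81), Lemma 1.3.6.6 and Cor. 1.3.6.7 (pp. 81–82)]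
[cite: Milne2005ShimuraVarieties, §6 Thm. 6.11 pp. 74–75 and §12 (63) p. 116] [cite: MumfordFogartyKirwan1994, Ch. 6 §2 Definition 6.3 (p. 120)] -/
theorem organB1_holds :
  ∀ (F : Type) [Field F] [NumberField F] [IsCMField F] [IsGalois ℚ F] (ι₁ : F →+* ℂ)
    (Jstar : Matrix (Fin 2) (Fin 2) F) (_hJ : (Jstar.map (IsCMField.complexConj F))ᵀ = Jstar) (_hJu : IsUnit Jstar)
    (K₀ : C5.OpenCompactSubgroup (GSAdele F Jstar)) (S : RecordSystemGS F Jstar ι₁ K₀) (_hU7ₛ : S.HeckeTranslateDefinedOver) (Kc : C5.SmallLevel K₀)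
    (Fi : Type) [Field Fi] [NumberField Fi] [Algebra F Fi] [IsGalois F Fi] (τE : Fi →+* ℂ) (_hτE : τE.comp (algebraMap F Fi) = ι₁)
    (Φ : Set (F →+* ℂ)) (hΦ : IsCMTypeThrough ι₁ Φ) (C : AuxChartGS F ι₁ Jstar K₀ S Kc Fi τE Φ)
    (ξ : F) (k : ℕ) (Fr : SymplecticFrameV F (RingHom.id F) Jstar ((k : ℚ) • ξ) C.g C.δ) (_hpin : IsChartOfFrame hΦ C ξ k Fr)
    (ε : (Literature.AlgebraicGeometry.Motives.baseChange F Fi).obj (S.M.obj Kc) ⟶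
        (Literature.AlgebraicGeometry.Motives.baseChange ℚ Fi).obj C.𝓜.M)
    (_hε : letI : Algebra Fi ℂ := τE.toAlgebra
      ∀ (P : ComplexPoints ((Literature.AlgebraicGeometry.Motives.baseChange F Fi).obj (S.M.obj Kc)))
        (Pflat : letI : Algebra F ℂ := ι₁.toAlgebra; ComplexPoints (S.M.obj Kc)),
        Pflat.left = P.left ≫ pullback.fst (S.M.obj Kc).hom (bcSpec F Fi) →
        (AlgPoints.map ε P).left ≫ pullback.fst C.𝓜.M.hom (bcSpec ℚ Fi) =
          (letI : Algebra F ℂ := ι₁.toAlgebra; (C.f (S.pts Kc Pflat)).left))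
    (ρ : AbelianSchemeOver.RingAction (𝓞 F) (C.𝓜.univ.baseChange (ε.left ≫ pullback.fst C.𝓜.M.hom (bcSpec ℚ Fi))).A),
    RingActionReading C ε ρ →
    ∀ (𝔞 : Ideal (𝓞 F)) (n : ℕ) (t : ↥(torusFinAdelic F)),
      𝔞 ≠ ⊥ → Ideal.span {((n : ℕ) : 𝓞 F)} = 𝔞 * (IsCMField.complexConj F) • 𝔞 → 𝔞 ⊔ Ideal.span {((C.N : ℕ) : 𝓞 F)} = ⊤ →
      FiniteAdeleRing.toFractionalIdeal (𝓞 F) F (t : (FiniteAdeleRing (𝓞 F) F)ˣ) = ((𝔞 : FractionalIdeal (𝓞 F)⁰ F))⁻¹ →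
      (∀ v : HeightOneSpectrum (𝓞 F), Ideal.span {((C.N : ℕ) : 𝓞 F)} ≤ v.asIdeal →
        Valued.v (((t : (FiniteAdeleRing (𝓞 F) F)ˣ) : FiniteAdeleRing (𝓞 F) F) v) = 1 ∧
        Valued.v (((t : (FiniteAdeleRing (𝓞 F) F)ˣ) : FiniteAdeleRing (𝓞 F) F) v - 1) ≤
          WithZero.exp (-(modulusExp (Ideal.span {((C.N : ℕ) : 𝓞 F)}) v : ℤ))) →
      letI P := C.𝓜.univ.baseChange (ε.left ≫ pullback.fst C.𝓜.M.hom (bcSpec ℚ Fi))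
      letI : Algebra F ℂ := ι₁.toAlgebra
  ∀ [IsCommMonObj P.A.X] (m : ℕ) (E' : Matrix (Fin m) (Fin m) (𝓞 F)) (hE' : E' * E' = E') (Pm : Matrix (Fin m) (Fin 1) (𝓞 F))
    (Qm : Matrix (Fin 1) (Fin m) (𝓞 F)),
    E' * Pm = Pm → Qm * E' = Qm → Qm * Pm = Matrix.scalar (Fin 1) ((n : ℕ) : 𝓞 F) → Pm * Qm = Matrix.scalar (Fin m) ((n : ℕ) : 𝓞 F) * E' →
    Ideal.span (Set.range fun j => Pm j 0) = 𝔞 →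
    ∀ (Db : (AbelianSchemeOver.serreTensor ρ E' hE').DualPair)
      (_hDb : Nonempty ((Scheme.Modules.pullback (AbelianSchemeOver.DualPair.unitHatSlice Db)).obj Db.P ≅ SheafOfModules.unit _))
      (polB : (AbelianSchemeOver.serreTensor ρ E' hE').Polarization Db)
      (lvl' : (AbelianSchemeOver.serreTensor ρ E' hE').LevelStructure C.g C.N),
      AbelianSchemeOver.IsExactTwistPol ρ E' hE' Pm P.D Db P.pol n polB.lam →
      (∀ i, lvl'.σ i = P.level.σ i ≫ AbelianSchemeOver.serreTranslate ρ E' hE' Pm) →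
      ∀ (eE : Fi →ₐ[F] ℂ), (∀ x, eE x = τE x) →
        ∀ (w : Fin 2 → F) (hw : (fun i => ι₁ (w i)) ∈ negCone (Jstar.map ι₁)) (a : GSAdele F Jstar),
          ∃ Θ : CartierDivisor ((AbelianSchemeOver.serreTensor ρ E' hE').fibre
              (thickeningLift eE (S.M.obj Kc) ((S.pts Kc).symm (ShimuraSetGS.mk F Jstar ι₁ Kc.1.1 (fun i => ι₁ (w i)) hw a))).left).toAbelianVariety.X.left,
            (AbelianSchemeOver.serreTensor ρ E' hE').IsLambdaOfAt
                (thickeningLift eE (S.M.obj Kc) ((S.pts Kc).symm (ShimuraSetGS.mk F Jstar ι₁ Kc.1.1 (fun i => ι₁ (w i)) hw a))).left Db polB.lam Θ ∧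
              Nonempty (lvl'.SymplecticLift
                (thickeningLift eE (S.M.obj Kc) ((S.pts Kc).symm (ShimuraSetGS.mk F Jstar ι₁ Kc.1.1 (fun i => ι₁ (w i)) hw a))).left Θ C.δ)

    := by
  intro F _ _ _ _ ι₁ Jstar hJ hJu K₀ S hU7ₛ Kc Fi _ _ _ _ τE hτE Φ hΦ C ξ k Fr hpin ε hε ρ hρ 𝔞 n t h𝔞 hrow_a hrow_b hz hcong instComm
    m E' hE' Pm Qm hP hQ hQP hPQ hspan Db hDb polB lvl' hex h5 eE heE w hw a
  letI : Algebra F ℂ := ι₁.toAlgebra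
  letI : Algebra Fi ℂ := τE.toAlgebra
  let P := C.𝓜.univ.baseChange (ε.left ≫ pullback.fst C.𝓜.M.hom (bcSpec ℚ Fi))
  -- `n ≠ 0` from rows (a)(c)
  have hn : n ≠ 0 := by
    intro hn
    have h0 : 𝔞 * (IsCMField.complexConj F) • 𝔞 ≠ ⊥ :=
      mul_ne_zero h𝔞 (Literature.NumberTheory.NumberFields.pointwise_smul_ne_bot (IsCMField.complexConj F) h𝔞)
    apply h0
    rw [← hrow_a, hn, Nat.cast_zero, Ideal.span_singleton_eq_bot]
  have hN0 : C.N ≠ 0 := by have := C.hN; omega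
  -- the multiplier of the torus idèle: `t · t̄ = q ⊗ 1` (the defining witness of `torusFinAdelic`)
  have hq₀ := (Literature.AlgebraicGeometry.ShimuraVarieties.UnitaryCanonicalModel.Aux.mem_torusFinAdelic_iff F
    (t : (FiniteAdeleRing (𝓞 F) F)ˣ)).1 t.2
  obtain ⟨q, hq⟩ := hq₀
  -- the sheet point `x := ℓ_{eE}(z₀)` as a `τE`-complex point of `X`, with flat shadow `z₀`
  have heE' : (eE : Fi →+* ℂ) = τE := RingHom.ext heE
  let z₀ : ComplexPoints (S.M.obj Kc) := (S.pts Kc).symm (ShimuraSetGS.mk F Jstar ι₁ Kc.1.1 (fun i => ι₁ (w i)) hw a)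
  let x : ComplexPoints ((Literature.AlgebraicGeometry.Motives.baseChange F Fi).obj (S.M.obj Kc)) :=
    Over.homMk (thickeningLift eE (S.M.obj Kc) z₀).left (by
      change (thickeningLift eE (S.M.obj Kc) z₀).left ≫ pullback.snd (S.M.obj Kc).hom (bcSpec F Fi) =
        Spec.map (CommRingCat.ofHom (algebraMap Fi ℂ))
      rw [Literature.AlgebraicGeometry.Motives.thickeningLift_left_comp_snd, heE'])
  have hx : z₀.left = x.left ≫ pullback.fst (S.M.obj Kc).hom (bcSpec F Fi) :=
    (Literature.AlgebraicGeometry.Motives.thickeningLift_left_comp_fst eE (S.M.obj Kc) z₀).symm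
  -- DEAL #42 §1 at `x`: σ1՚s marked fibre of `P_x` and the marking `m_B` of the twisted fibre reading the cover as `id`
  have hσ₁ := exists_markedSerreTensorFibre hΦ C ξ k Fr hpin ε ρ hρ x z₀ hx 𝔞 h𝔞 t hz E' hE' Pm Qm hn hP hQ hQP hPQ hspan
  obtain ⟨v, hv, a', k', mk, Θ, Λ, mB, -, hk', hrepk, -, hlam, hlvl, -, -, -, -, -, -, -, hmB, -⟩ := hσ₁
  -- `Λ` is read by `m` through `k · r′⁻¹ = rep⁻¹`
  have hkr : k' * ((gspRationalToFinAdelic C.δ (C.q a'))⁻¹ * C.b a')⁻¹ = (C.rep (C.piece a'))⁻¹ := by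
    rw [hrepk]; group
  have hlvl' : ∀ ⦃M : ℕ⦄, C.N ∣ M → M ≠ 0 → ∀ (y : Fin C.g ⊕ Fin C.g → ZMod M) (w' : Fin C.g ⊕ Fin C.g → ℚ),
      AdelicCongr ((k' * ((gspRationalToFinAdelic C.δ (C.q a'))⁻¹ * C.b a')⁻¹ : ↥(gspFinAdelic C.δ)) : GL (Fin C.g ⊕ Fin C.g) finAdeleQ) 1 w'
          (fun i => ((y i).val : ℚ) / M) →
        ((Λ.lift M (Multiplicative.ofAdd y)) : (P.A.fibre x.left).toAbelianVariety.Points ℂ) = mk.r w' := by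
    intro M hM hM0 y w' hw'
    rw [hkr] at hw'
    exact hlvl hM hM0 y w' hw'
  -- the rows of the twist needed at the point: (t3) = `IsExactTwistPol`, (surj) from the presentation
  haveI := AbelianSchemeOver.isMonHom_serreTranslate ρ E' hE' Pm
  have hex' := (AbelianSchemeOver.isExactTwistPol_iff ρ E' hE' Pm P.D Db P.pol n polB.lam).1 hex
  have hrows := AbelianSchemeOver.serreCover_rows_of_presentation ρ E' hE' Pm Qm hn hP hQ hQP hPQ hspan
  obtain ⟨-, -, hsurj, -, -⟩ := hrows
  haveI : Surjective (AbelianSchemeOver.serreTranslate ρ E' hE' Pm).left := ⟨hsurj⟩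
  -- DEAL #41 at the torus leg
  have hlift := exists_isLambdaOfAt_symplecticLift_torusLeg C.hδ C.hg Fr C.ρ₀ hpin.2.2.2 t 𝔞 h𝔞 hz hn hrow_a hN0 hcong q hq
    (AbelianSchemeOver.serreTranslate ρ E' hE' Pm) P.level lvl' h5 P.pol polB hex' hk' Θ hlam Λ mk hlvl' mB hmB
  obtain ⟨Θ₂, -, hΘ₂, Λ₂, -⟩ := hlift
  exact ⟨Θ₂, hΘ₂, ⟨Λ₂⟩⟩

end Summit.HodgeConjecture.HodgeConjecture.Theorems.F0P6aOrganB1FibreLift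

end
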